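import Summits.BirchSwinnertonDyer.BirchSwinnertonDyer.Theorems.ThetaPartnerAtTwoSignedMainConjectureCMTwoRankZeroOfLocal
import HarnessLib

/-!
# Route `ThetaPartnerAtTwo` (TP2), crux K2r0 `SignedMainConjectureCMTwoRankZero` (stmt-BirchSwinnertonDyer-20312),
# line `rankzero` v9: at analytic rank `0` the `+` main conjecture at `2` MODULO POWERS OF `2` is already the EXACT
# main conjecture — the Eisenstein half (E)_A is replaced by the weaker-looking, `p = 2`-natural stub
# «`char X⁺ = (g)` with `2^{m'}·g = 2^m·ϖ·L♭`»

HONEST FRAMING (cell `pub/bsd-wall`, W-ALL row 1, lead prover `bsd-wall-tp2-p2` g4). Nothing here is the crux; the crux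
(Pollack–Rubin 2004 Thm. 7.3 at `p = 2` + `μ⁺ = 0` for CM rank-0 `A`) is NOT in print and NOT proved here. WHY THIS FILE:
every PRINTED Euler-system / equivariant statement for imaginary quadratic fields AT `p = 2` is a main conjecture UP TO A
POWER OF `2` — Oukhaba 2010 / Viguié 2011 (arXiv:1103.1125 Thm. 1.1 (ii): `char(A_∞,χ) ∣ 𝔲^{m_χ}·char(𝓔_∞/𝓒_∞)_χ` for
`p ∈ {2,3}`), Viguié 2012 (JTNB, arXiv:1102.4705 Thm. 5.1 (ii): `char(𝓤_∞/𝓒_∞)_χ = (𝔲^{−m_χ}·L_χ)` at `p = 2`; "raw form"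
`𝔲^a char(A_∞,χ) = 𝔲^b char(𝓔/𝓒)_χ`), Johnson-Leung–Kings / Burungale–Flach 2024 Thm. 4.1 (determinant form; Remark 7: the
character-ideal form only for `p ∤ |𝒪_K^×|·|G^tor|`) — because the torsion of `G = Gal(K(A[2^∞])/K) ≅ 𝒪_𝔭^×` is `μ₆ ∋ −1`
and `−1` acts on `T_𝔭A` by `−1`: the `μ₃`-isotypic splitting is exact (odd order; crux idea `omega-isotypic-rubin-at-inert-two`)
but the `μ₂`-part only gives `Ĥ^*(μ₂, ·)`-terms of exponent `2`, i.e. statements modulo powers of `2`. THIS FILE shows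
that AT ANALYTIC RANK `0` such a fudge is harmless for the main-conjecture conclusion: BSD₂(A) (Burungale–Flach, IN PRINT)
and Kim's control term pin `ord₂ g(0) = ord₂ (ϖ·L♭)(0)`, so `2^{m'}·g = 2^m·ϖ·L♭` forces `m = m'` and `g = ϖ·L♭`.

* §0 (private copy of the `T = 0` valuation identity of p518019 §0, route-independent).
* §1 `kobayashiMainConjecture_two_one_conclusion_of_upToTwoPower` — datum by datum: `char X⁺ = (g)`,
  `2^{m'}·ι g = 2^m·ϖ·ι L♭` (+ GZK, BSD₂, Kim's term, torsion) ⇒ `ι g = ϖ·ι L♭` (the body of `KobayashiMainConjecture A 2 1`).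
* §2 `kobayashiLowerDivisibility_of_upToTwoPower` — CM `A` of analytic rank `0`: PUB + (T2)_A + (K4c)_A + the up-to-`2`-power
  statement at every datum ⇒ `KobayashiLowerDivisibility A 2 1` (with cofactor `h = 1`).
* §3 `signedMainConjectureCMTwoRankZero_at_of_local_of_upToTwoPower` — the v9 composition door: LOCAL⁺@2(A) (K4's three local
  stubs read for `A`) + PUB + «MC up to `2`-powers» + (μ♭)_A ⇒ both conjuncts of the crux AT `A`
  (through `signedMainConjectureCMTwoRankZero_at_of_local`, p585652).
Nothing about any curve is asserted; every research input is a displayed binder; BSD is not proved by any of this.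

References: [PollackRubin2004] Thm. 7.3 (p > 2); [BurungaleFlach2024] Thm. 1.1, Thm. 4.1, Remark 7; [Kobayashi2003] Thm. 1.2,
Conjecture (p. 2), (3.6); [BDKim2013] Cor. 3.15; [Washington1997] §7.1, §13.2; [Miller2011LMS] Def. 1.1; Viguié, arXiv:1103.1125
Thm. 1.1; Viguié, JTNB 24 (2012) (arXiv:1102.4705) Thm. 5.1.
-/

set_option autoImplicit false
-- the Theorems namespace of this sub repeats the summit name by design (D-0017 nested layout)
set_option linter.dupNamespace false

noncomputable section

open scoped Classical NumberField MatrixGroups ModularForm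

open NumberField IsDedekindDomain CongruenceSubgroup

namespace Summit.BirchSwinnertonDyer.BirchSwinnertonDyer.Theorems

open Literature.NumberTheory.EllipticCurves Literature.NumberTheory.GaloisRepresentations
  WeierstrassCurve ZpExtension Literature.NumberTheory.EllipticCurves.Kobayashi2003
  Literature.NumberTheory.EllipticCurves.IwasawaDual Literature.NumberTheory.EllipticCurves.GreenbergVatsal2000
  Literature.NumberTheory.EllipticCurves.ModularForms Literature.NumberTheory.EllipticCurves.Rank1Residual
  Literature.NumberTheory.EllipticCurves.Rank1Residual.Typed
  Summit.BirchSwinnertonDyer.Rank1Residual Summit.BirchSwinnertonDyer.Rank1Residual.Supersingular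

variable (A : WeierstrassCurve ℚ) [A.IsElliptic] [A.IsGloballyMinimal]

/-! ## §0. The `T = 0` valuation identity (route-independent private copy of p518019 §0) -/

/-- `ord₂ g(0) = ord₂ L(E,1)/Ω_E` from BSD₂ + GZK + Kim's control term at `2` (good supersingular at `2`,
`L(E,1) ≠ 0`, `D` a f.g. torsion dual datum of `Sel⁺(E/ℚ_∞)`, `g` a generator of `char X⁺`): the statement and proof
of p518019 §0 / p509213 §4, repeated privately so that this file imports no route module.
[cite: BDKim2013, Cor. 3.15 (p. 199; p odd in print)] [cite: Miller2011LMS, Def. 1.1] -/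
private theorem valuation_constantCoeff_generator_aux'
    (hGZK : rank_eq_analyticRank_of_analyticRank_le_one)
    (hss : GoodSS A 2) (hL : A.entireLFunction 1 ≠ 0) (hBSD : BSDp A 2)
    (hKim : ∀ (κ : ZpExtension ℚ 2) (γ : Field.absoluteGaloisGroup ℚ),
      κ.IsCyclotomic → κ.IsTopGenerator γ →
      ∀ (D : SignedSelmerDualData A κ γ 1) [Module.Finite (IwasawaAlgebra 2) D.X],
        Module.IsTorsion (IwasawaAlgebra 2) D.X →
      ∀ g : IwasawaAlgebra 2, D.charIdeal = Ideal.span {g} → Finite (A.selmerGroupPInfty 2) →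
        ∃ u : ℤ_[2]ˣ, ((PowerSeries.constantCoeff g : ℤ_[2]) : ℚ_[2]) =
          ((u : ℤ_[2]) : ℚ_[2]) * ((2 : ℕ) : ℚ_[2]) ^ (padicValNat 2 A.tamagawaProduct) *
            (Nat.card (A.selmerGroupPInfty 2) : ℚ_[2]))
    {κ : ZpExtension ℚ 2} {γ : Field.absoluteGaloisGroup ℚ} (hκ : κ.IsCyclotomic)
    (hγ : κ.IsTopGenerator γ) (D : SignedSelmerDualData A κ γ 1)
    [Module.Finite (IwasawaAlgebra 2) D.X] (hTors : Module.IsTorsion (IwasawaAlgebra 2) D.X)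
    {g : IwasawaAlgebra 2} (hchar : D.charIdeal = Ideal.span {g})
    {t : ℚ} (ht : A.entireLFunction 1 / (A.realPeriodRat : ℂ) = (t : ℂ)) :
    ((PowerSeries.constantCoeff g : ℤ_[2]) : ℚ_[2]) ≠ 0 ∧
      (((PowerSeries.constantCoeff g : ℤ_[2]) : ℚ_[2])).valuation = padicValRat 2 t := by
  have hr : A.analyticRank = 0 := analyticRank_eq_zero_of_entireLFunction_one_ne_zero A hL
  have hirr : A.HasIrreducibleModPGaloisRep 2 := P2.irr_two_of_goodSS_two A hss
  have hΩ : (A.realPeriodRat : ℂ) ≠ 0 := Complex.ofReal_ne_zero.mpr A.realPeriodRat_pos_holds.ne'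
  have ht0 : t ≠ 0 := by
    rintro rfl
    apply hL
    have h := ht
    rw [div_eq_iff hΩ] at h
    rw [h]
    simp
  have hK : (⟨g, 0, 0⟩ : SignedDatum A 2).EulerCharacteristic := fun hfin ↦
    hKim κ γ hκ hγ D hTors g hchar hfin
  obtain ⟨hne, hvg⟩ := valuation_constantCoeff_xi A 2 hGZK hL ⟨g, 0, 0⟩ hK
  haveI : Finite A.sha := (hGZK A (by omega)).2
  obtain ⟨q, hq, hv⟩ := missingPPartAt_of_bsdp A 2 hBSD
  have hsha := shaAn_eq_of_analyticRank_eq_zero A hGZK hr ht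
  have hqt : q = t * (A.torsionOrder : ℚ) ^ 2 / (A.tamagawaProduct : ℚ) := by
    have h := hq.symm.trans hsha
    exact_mod_cast h
  rw [hqt, padicValRat_shaAn_witness A 2 hirr ht0] at hv
  refine ⟨hne, ?_⟩
  rw [hvg]
  linarith

/-! ## §1. MC modulo powers of `2` at a datum + matching constant terms ⇒ MC exactly at that datum -/

/-- **At a curve with `L(W,1) ≠ 0` and BSD₂ known, the `+` main conjecture at `2` MODULO POWERS OF `2` is the
main conjecture.** `W` globally minimal, good supersingular at `2`, `a₂ = 0`, `L(W,1) ≠ 0`; grant GZK (`hGZK`),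
`BSDp W 2` (`hBSD`) and Kim's control term at `2` (`hKim`); let `(κ, γ)` be cyclotomic with a top generator, `D` a f.g.
torsion dual datum of `Sel⁺(W/ℚ_∞)`, `f` a newform with period ratio `ϖ`, `(L⁺, L⁻)` a Pollack pair at `2`, and
`char X⁺ = (g)` with `2^{m'}·ι g = 2^m·ϖ·ι L⁻` in `ℚ₂⟦T⟧`. Then `ι g = ϖ·ι L⁻` EXACTLY: `ord₂ g(0) = ord₂ (ϖ·L⁻)(0)`
(`= ord₂ L(W,1)/Ω_W`, §0 and `constantCoeff_neronPlus_two_eq`) forces `m = m'`, and `ℚ₂⟦T⟧` is a domain.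
[cite: Kobayashi2003, Conjecture (p. 2) and (3.6)] [cite: BDKim2013, Cor. 3.15 (p odd in print)] [cite: Miller2011LMS, Def. 1.1] -/
theorem kobayashiMainConjecture_two_one_conclusion_of_upToTwoPower
    (hGZK : rank_eq_analyticRank_of_analyticRank_le_one)
    (hss : GoodSS A 2) (ha : A.frobeniusTrace 2 = 0) (hL : A.entireLFunction 1 ≠ 0)
    (hBSD : BSDp A 2)
    (hKim : ∀ (κ : ZpExtension ℚ 2) (γ : Field.absoluteGaloisGroup ℚ),
      κ.IsCyclotomic → κ.IsTopGenerator γ →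
      ∀ (D : SignedSelmerDualData A κ γ 1) [Module.Finite (IwasawaAlgebra 2) D.X],
        Module.IsTorsion (IwasawaAlgebra 2) D.X →
      ∀ g : IwasawaAlgebra 2, D.charIdeal = Ideal.span {g} → Finite (A.selmerGroupPInfty 2) →
        ∃ u : ℤ_[2]ˣ, ((PowerSeries.constantCoeff g : ℤ_[2]) : ℚ_[2]) =
          ((u : ℤ_[2]) : ℚ_[2]) * ((2 : ℕ) : ℚ_[2]) ^ (padicValNat 2 A.tamagawaProduct) *
            (Nat.card (A.selmerGroupPInfty 2) : ℚ_[2]))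
    {κ : ZpExtension ℚ 2} {γ : Field.absoluteGaloisGroup ℚ} (hκ : κ.IsCyclotomic)
    (hγ : κ.IsTopGenerator γ) (D : SignedSelmerDualData A κ γ 1)
    [Module.Finite (IwasawaAlgebra 2) D.X] (hTors : Module.IsTorsion (IwasawaAlgebra 2) D.X)
    [NeZero (A.conductorNorm ℤ)] {f : CuspForm (Gamma0 (A.conductorNorm ℤ)) 2} (hf : IsNewformOf A f)
    {ϖ : ℚ} (hϖ : (ϖ : ℝ) * A.realPeriodRat = plusPeriod f)
    {Lplus Lminus : IwasawaAlgebra 2} (hPP : IsPollackPair f 2 Lplus Lminus)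
    {g : IwasawaAlgebra 2} (hchar : D.charIdeal = Ideal.span {g}) {m m' : ℕ}
    (hup : PowerSeries.C ((2 : ℚ_[2]) ^ m') * iwasawaToPowerSeries 2 g =
      PowerSeries.C ((2 : ℚ_[2]) ^ m * (ϖ : ℚ_[2])) * iwasawaToPowerSeries 2 (kobayashiL 1 Lplus Lminus)) :
    iwasawaToPowerSeries 2 g = PowerSeries.C (ϖ : ℚ_[2]) * iwasawaToPowerSeries 2 (kobayashiL 1 Lplus Lminus) := by
  obtain ⟨hΦ0, ht⟩ := constantCoeff_neronPlus_two_eq A hf hss.1 ha hϖ hPP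
  set Φ := PowerSeries.C (ϖ : ℚ_[2]) * iwasawaToPowerSeries 2 (kobayashiL 1 Lplus Lminus) with hΦ
  set t : ℚ := ϖ * ratPlusSymbol f 0 with ht_def
  -- `ord₂ g(0) = ord₂ t`
  obtain ⟨hg0, hval⟩ := valuation_constantCoeff_generator_aux' A hGZK hss hL hBSD hKim hκ hγ D hTors hchar ht
  have hΩ : (A.realPeriodRat : ℂ) ≠ 0 := Complex.ofReal_ne_zero.mpr A.realPeriodRat_pos_holds.ne'
  have ht0 : t ≠ 0 := by
    intro h0
    apply hL
    have h := ht
    rw [h0, div_eq_iff hΩ] at h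
    rw [h]
    simp
  have htQ0 : ((t : ℚ) : ℚ_[2]) ≠ 0 := by exact_mod_cast ht0
  have h20 : (2 : ℚ_[2]) ≠ 0 := two_ne_zero
  -- the identity rewritten as `C(2^m') · ι g = C(2^m) · Φ`
  have hup' : PowerSeries.C ((2 : ℚ_[2]) ^ m') * iwasawaToPowerSeries 2 g = PowerSeries.C ((2 : ℚ_[2]) ^ m) * Φ := by
    rw [hup, hΦ, map_mul, mul_assoc]
  -- constant terms: `2^m' · g(0) = 2^m · t`
  have hc := congrArg PowerSeries.constantCoeff hup'
  rw [map_mul, PowerSeries.constantCoeff_C, constantCoeff_iwasawaToPowerSeries, map_mul,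
    PowerSeries.constantCoeff_C, hΦ0] at hc
  have hv := congrArg Padic.valuation hc
  rw [Padic.valuation_mul (pow_ne_zero _ h20) hg0, Padic.valuation_mul (pow_ne_zero _ h20) htQ0, hval,
    Padic.valuation_ratCast] at hv
  have hpm : ((2 : ℚ_[2]) ^ m).valuation = (m : ℤ) := by
    rw [show (2 : ℚ_[2]) ^ m = ((2 ^ m : ℕ) : ℚ_[2]) by push_cast; rfl, Padic.valuation_natCast,
      padicValNat.prime_pow]
  have hpm' : ((2 : ℚ_[2]) ^ m').valuation = (m' : ℤ) := by
    rw [show (2 : ℚ_[2]) ^ m' = ((2 ^ m' : ℕ) : ℚ_[2]) by push_cast; rfl, Padic.valuation_natCast,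
      padicValNat.prime_pow]
  rw [hpm, hpm'] at hv
  have hmm : m' = m := by exact_mod_cast (by linarith : (m' : ℤ) = m)
  rw [hmm] at hup'
  exact mul_left_cancel₀ ((map_ne_zero_iff _ (PowerSeries.C_injective (R := ℚ_[2]))).mpr (pow_ne_zero _ h20)) hup'

/-! ## §2. (E)_A for a CM curve of analytic rank `0` from the main conjecture modulo powers of `2` -/

/-- **The Eisenstein half `KobayashiLowerDivisibility A 2 1` from «MC modulo powers of `2`» at analytic rank `0`.**
`A/ℚ` CM, globally minimal, analytic rank `0`, good supersingular at `2`, `a₂ = 0`; grant BY NAME Burungale–Flach (`hBF`: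
BSD₂(A)), the entire continuation (`hLrat`), GZK (`hGZK`); and, READ FOR `A`, (T2)_A (`hT2`: torsion of every dual datum),
(K4c)_A (`hKim`) and (MC±2^k)_A (`hup`): at every normalised cyclotomic datum, `char X⁺ = (g)` with
`2^{m'}·ι g = 2^m·ϖ·ι L♭` for some `m, m'`. Then `KobayashiLowerDivisibility A 2 1` (cofactor `h = 1`; in fact the exact
main-conjecture identity, §1). [cite: BurungaleFlach2024, Thm. 1.1] [cite: Kobayashi2003, Conjecture (p. 2)]
[cite: PollackRubin2004, Thm. 7.3 (p > 2)] -/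
theorem kobayashiLowerDivisibility_of_upToTwoPower
    (hBF : bsdTriple_of_hasCM_of_L_one_ne_zero) (hLrat : hasEntireLFunction_rat)
    (hGZK : rank_eq_analyticRank_of_analyticRank_le_one)
    (hcm : A.HasCM) (hr : A.analyticRank = 0) (hss : GoodSS A 2) (ha : A.frobeniusTrace 2 = 0)
    (hT2 : ∀ (κ : ZpExtension ℚ 2) (γ : Field.absoluteGaloisGroup ℚ),
      κ.IsCyclotomic → κ.IsTopGenerator γ →
      ∀ D : SignedSelmerDualData A κ γ 1, Module.IsTorsion (IwasawaAlgebra 2) D.X)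
    (hKim : ∀ (κ : ZpExtension ℚ 2) (γ : Field.absoluteGaloisGroup ℚ),
      κ.IsCyclotomic → κ.IsTopGenerator γ →
      ∀ (D : SignedSelmerDualData A κ γ 1) [Module.Finite (IwasawaAlgebra 2) D.X],
        Module.IsTorsion (IwasawaAlgebra 2) D.X →
      ∀ g : IwasawaAlgebra 2, D.charIdeal = Ideal.span {g} → Finite (A.selmerGroupPInfty 2) →
        ∃ u : ℤ_[2]ˣ, ((PowerSeries.constantCoeff g : ℤ_[2]) : ℚ_[2]) =
          ((u : ℤ_[2]) : ℚ_[2]) * ((2 : ℕ) : ℚ_[2]) ^ (padicValNat 2 A.tamagawaProduct) *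
            (Nat.card (A.selmerGroupPInfty 2) : ℚ_[2]))
    (hup : ∀ (κ : ZpExtension ℚ 2) (γ : Field.absoluteGaloisGroup ℚ),
      κ.IsCyclotomic → κ.IsTopGenerator γ → IsCyclotomicVariable 2 γ →
      ∀ [NeZero (A.conductorNorm ℤ)] (f : CuspForm (Gamma0 (A.conductorNorm ℤ)) 2),
        IsNewformOf A f → ∀ (ϖ : ℚ), (ϖ : ℝ) * A.realPeriodRat = plusPeriod f →
      ∀ (Lplus Lminus : IwasawaAlgebra 2), IsPollackPair f 2 Lplus Lminus →
      ∀ (D : SignedSelmerDualData A κ γ 1),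
        ∃ (g : IwasawaAlgebra 2) (m m' : ℕ), D.charIdeal = Ideal.span {g} ∧
          PowerSeries.C ((2 : ℚ_[2]) ^ m') * iwasawaToPowerSeries 2 g =
            PowerSeries.C ((2 : ℚ_[2]) ^ m * (ϖ : ℚ_[2])) * iwasawaToPowerSeries 2 (kobayashiL 1 Lplus Lminus)) :
    KobayashiLowerDivisibility A 2 1 := by
  have hL : A.entireLFunction 1 ≠ 0 := (A.analyticRank_eq_zero_iff_holds (hLrat A)).mp hr
  have hBSD : BSDp A 2 :=
    forall_bsdp_of_bsdTriple A A.tamagawaProduct_pos_holds (hBF A hcm hL) 2 Nat.prime_two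
  intro κ γ hκ hγ hγ' _ f hf ϖ hϖ Lplus Lminus hPP D
  haveI := Kobayashi2003.SignedSelmerDualData.moduleFinite hγ D
  have hTors := hT2 κ γ hκ hγ D
  obtain ⟨g, m, m', hchar, hupD⟩ := hup κ γ hκ hγ hγ' f hf ϖ hϖ Lplus Lminus hPP D
  refine ⟨g, 1, hchar, ?_⟩
  rw [mul_one]
  exact kobayashiMainConjecture_two_one_conclusion_of_upToTwoPower A hGZK hss ha hL hBSD hKim hκ hγ D hTors hf hϖ
    hPP hchar hupD

/-! ## §3. The v9 composition door: LOCAL⁺@2 + PUB + «MC modulo powers of 2» + (μ♭)_A ⇒ the crux AT `A` -/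

/-- **K2r0 AT `A` from LOCAL⁺@2 + PUB + the main conjecture modulo powers of `2` + analytic `μ = 0`.** Same binders as
`signedMainConjectureCMTwoRankZero_at_of_local` (p585652) with the Eisenstein half (E)_A REPLACED by (MC±2^k)_A — Kobayashi's
`+` main conjecture at `2` for `A` modulo powers of `2`, the shape every printed `p = 2` Euler-system statement has (Viguié,
Oukhaba; Burungale–Flach Remark 7) — and (μ♭)_A kept: (T2)_A, (K4c)_A come from the three local statements (p585652 §§2–3),
(E)_A from §2, and the rest is p585652 §6. [cite: PollackRubin2004, Thm. 7.3 (p > 2)] [cite: BurungaleFlach2024, Thm. 1.1 and Remark 7]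
[cite: Kobayashi2003, Thm. 1.2, Conjecture (p. 2)] [cite: BDKim2013, Cor. 3.15] [cite: GreenbergLNM1716, §4] -/
theorem signedMainConjectureCMTwoRankZero_at_of_local_of_upToTwoPower
    (hBF : bsdTriple_of_hasCM_of_L_one_ne_zero)
    (hmod : nonempty_modularParametrizationData) (hLrat : hasEntireLFunction_rat)
    (hGZK : rank_eq_analyticRank_of_analyticRank_le_one)
    (h2 : Literature.NumberTheory.EllipticCurves.realPeriodRat_eq_unit_mul_plusPeriod_two)
    (hC : Greenberg1999.casselsSurjectivity_H1Sigma ℚ)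
    (h412 : Greenberg1999.prop412_noFiniteSubmodule_H1Sigma_of_rank_one)
    (hcork : Greenberg1999.h1Sigma_zpCorank_le_degree ℚ)
    (hP108 : Greenberg1999.localQuotient_restriction_surjective ℚ)
    (hWL : Greenberg1999.h1SigmaInfty_rank_eq_one)
    (hcm : A.HasCM) (hr : A.analyticRank = 0) (hss : GoodSS A 2) (ha : A.frobeniusTrace 2 = 0)
    (hlev : ∀ (κ : ZpExtension ℚ 2), κ.IsCyclotomic →
      ∀ (v : HeightOneSpectrum (𝓞 ℚ)), (2 : 𝓞 ℚ) ∈ v.asIdeal →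
      ∃ m₀ ∈ localLayerPointsOfEmb κ (closureEmb (K := ℚ) (v.adicCompletion ℚ)) A 0,
        ∀ b ∈ localLayerPointsOfEmb κ (closureEmb (K := ℚ) (v.adicCompletion ℚ)) A 0, m₀ ≠ 2 • b)
    (hcyc : ∀ (κ : ZpExtension ℚ 2), κ.IsCyclotomic →
      ∀ (v : HeightOneSpectrum (𝓞 ℚ)), (2 : 𝓞 ℚ) ∈ v.asIdeal →
      ∀ n : ℕ, ∃ d ∈ signedLocalPoints κ (v.adicCompletion ℚ) A 1 n,
        ∀ x ∈ signedLocalPoints κ (v.adicCompletion ℚ) A 1 n,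
        ∃ B ∈ AddSubgroup.closure (Set.range fun σ : Field.absoluteGaloisGroup (v.adicCompletion ℚ) ↦ σ • d),
          ∃ b ∈ signedLocalPoints κ (v.adicCompletion ℚ) A 1 n, x = B + 2 • b)
    (hlocK : ∀ (κ : ZpExtension ℚ 2), κ.IsCyclotomic →
      ∀ t : A.subgroupH1 2 κ.kerSubgroup,
        (∀ σ : Field.absoluteGaloisGroup ℚ, A.conjH1 2 κ.kerSubgroup σ t - t ∈ signedSelmerInfty A κ 1) →
        ∀ w : HeightOneSpectrum (𝓞 ℚ), ((2 : ℕ) : 𝓞 ℚ) ∈ w.asIdeal →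
        ∃ xw : discreteH1 (localSubgroup (⊤ : Subgroup (Field.absoluteGaloisGroup ℚ)) (w.adicCompletion ℚ))
            (localPoints A (w.adicCompletion ℚ)),
          (∃ k : ℕ, 2 ^ k • xw = 0) ∧
          ∀ y : A.subgroupH1 2 (⊤ : Subgroup (Field.absoluteGaloisGroup ℚ)),
            A.localResOver 2 ⊤ (w.adicCompletion ℚ) y = xw →
            t - A.resOfLe 2 (le_top : κ.kerSubgroup ≤ ⊤) y ∈
              localKummerOverOfEmb A 2 κ.kerSubgroup (closureEmb (K := ℚ) (w.adicCompletion ℚ))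
                (⨆ n, signedLocalPoints κ (w.adicCompletion ℚ) A 1 n))
    (hup : ∀ (κ : ZpExtension ℚ 2) (γ : Field.absoluteGaloisGroup ℚ),
      κ.IsCyclotomic → κ.IsTopGenerator γ → IsCyclotomicVariable 2 γ →
      ∀ [NeZero (A.conductorNorm ℤ)] (f : CuspForm (Gamma0 (A.conductorNorm ℤ)) 2),
        IsNewformOf A f → ∀ (ϖ : ℚ), (ϖ : ℝ) * A.realPeriodRat = plusPeriod f →
      ∀ (Lplus Lminus : IwasawaAlgebra 2), IsPollackPair f 2 Lplus Lminus →
      ∀ (D : SignedSelmerDualData A κ γ 1),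
        ∃ (g : IwasawaAlgebra 2) (m m' : ℕ), D.charIdeal = Ideal.span {g} ∧
          PowerSeries.C ((2 : ℚ_[2]) ^ m') * iwasawaToPowerSeries 2 g =
            PowerSeries.C ((2 : ℚ_[2]) ^ m * (ϖ : ℚ_[2])) * iwasawaToPowerSeries 2 (kobayashiL 1 Lplus Lminus))
    (hflat : ∀ [NeZero (A.conductorNorm ℤ)] (f : CuspForm (Gamma0 (A.conductorNorm ℤ)) 2),
      IsNewformOf A f → ∀ (Lplus Lminus : IwasawaAlgebra 2), IsPollackPair f 2 Lplus Lminus →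
        ∃ n : ℕ, IsUnit (PowerSeries.coeff n (kobayashiL 1 Lplus Lminus))) :
    (∀ (κ : ZpExtension ℚ 2) (γ : Field.absoluteGaloisGroup ℚ), κ.IsCyclotomic → κ.IsTopGenerator γ →
      ∀ D : SignedSelmerDualData A κ γ 1, Module.IsTorsion (IwasawaAlgebra 2) D.X ∧ D.mu = 0) ∧
    KobayashiMainConjecture A 2 1 := by
  have hSel : Finite (A.selmerGroupPInfty 2) := finite_selmerGroupPInfty_two_of_analyticRank_eq_zero A hGZK hr
  have hEC := fun (κ : ZpExtension ℚ 2) (γ : Field.absoluteGaloisGroup ℚ) (hκ : κ.IsCyclotomic)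
      (hγ : κ.IsTopGenerator γ) (hSel' : Finite (A.selmerGroupPInfty 2)) ↦
    signedEulerCharTwo_at_of_local A hss hκ hγ (hlev κ hκ) (hcyc κ hκ) (hlocK κ hκ) hC h412 hcork hP108 hWL hSel'
  have hT2 : ∀ (κ : ZpExtension ℚ 2) (γ : Field.absoluteGaloisGroup ℚ), κ.IsCyclotomic → κ.IsTopGenerator γ →
      ∀ D : SignedSelmerDualData A κ γ 1, Module.IsTorsion (IwasawaAlgebra 2) D.X :=
    fun κ γ hκ hγ D ↦ (finiteTorsion_at_of_signedEulerCharTwo hEC hSel κ γ hκ hγ D).2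
  exact signedMainConjectureCMTwoRankZero_at_of_local A hBF hmod hLrat hGZK h2 hC h412 hcork hP108 hWL hcm hr hss ha
    hlev hcyc hlocK
    (kobayashiLowerDivisibility_of_upToTwoPower A hBF hLrat hGZK hcm hr hss ha hT2
      (kimControl_at_of_signedEulerCharTwo hEC) hup)
    hflat

end Summit.BirchSwinnertonDyer.BirchSwinnertonDyer.Theorems

end
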